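import Mathlib
import Literature.NumberTheory.ComplexMultiplication.ImprimitivityBound
import HarnessLib

/-!
# Pairwise-trivial subgroup triples of order `2^(m-1)·(m-1)!` in `S_{2m}` (hyperoctahedral point stabilisers)

Context (the `S_n` window, door D2(a) of the solo-informed memo).  [BCCGU17, arXiv:1712.02302, Thm 4.2]
proves that three YOUNG subgroups `H₁, H₂, H₃ ≤ S_n` with pairwise trivial intersections satisfy
`|H₁||H₂||H₃| ≤ n!^{3/2}·e^{-cn}` (an exponential loss against the `ω = 2` threshold `n!^{3/2}/e^{o(√n)}`),
and asks [loc. cit. §5, p. 11] for an extension "to all triples of subgroups (not just Young subgroups)";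
the authors remark [p. 10] that in `S_n × S_n` the pairwise-trivial hypothesis alone admits subgroups of the
square-root size `|G|^{1/2}`.  This file records the same phenomenon INSIDE the symmetric group:

* for every odd `m` and ANY three points `x₀ x₁ x₂`, the three subgroups
  `H_s := C_{S_{2m}}(τ_s) ∩ Stab(x_s)` (`s = 0, 1, 2`), where `τ_s` is the fixed-point-free involution
  `(false, k) ↔ (true, k - s)` of `Bool × ZMod m`, are PAIRWISE TRIVIALLY INTERSECTING
  (`stabCent_inf_eq_bot`), and each has order `2^(m-1)·(m-1)!` (`card_stabCent`) — so
  `|H_s|·(2m) = 2^m·m!` and `(|H_s|·2m)² ≥ (2m)!` (`card_stabCent_sq_ge`): the product of the three orders is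
  `≥ (2m)!^{3/2}/(2m)^3`, a POLYNOMIAL loss only;
* transported to `Equiv.Perm (Fin (2m))`: `exists_pairwise_trivial_triple`.

Hence the Young hypothesis in [BCCGU17, Thm 4.2] cannot be replaced by "arbitrary subgroups" while keeping
only the pairwise-trivial-intersection hypothesis: any extension of the Young barrier to all subgroup triples
must use the genuinely ternary triple-product condition `h₁h₂h₃ = 1 ⇒ h_i = 1`.  (Whether these
hyperoctahedral triples, or poly-index subgroups of them, can satisfy the TPP is examined numerically in the
accompanying note `paper/hyperoctahedral-note.md`: they do not for `2m = 10, 12, 14`.)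

Mechanism: `C(τ_s) ∩ C(τ_t)` centralises the group `⟨τ_s, τ_t⟩`, which is transitive as soon as `t - s` is a
unit of `ZMod m` (the two matchings form a Hamiltonian cycle); a permutation centralising a transitive group and
fixing a point is the identity (`eq_one_of_comm_of_apply_eq`).  The order count is orbit–stabiliser inside the
hyperoctahedral group `C(τ_s) ≅ S₂ ≀ S_m`, whose order `2^m·m!` is
`Literature.NumberTheory.ComplexMultiplication.nat_card_centralizer_of_involutive_fixedPointFree`.
-/

set_option autoImplicit false

namespace Summit.MatrixMultiplication.MatrixMultiplication.Theorems.HyperoctahedralPairwise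

open Equiv (Perm)

variable (m : ℕ)

/-- The vertex set `Bool × ZMod m` (two "levels" of a `2m`-cycle). -/
abbrev V := Bool × ZMod m

/-- The matching map with shift `s`: `(false, k) ↦ (true, k - s)`, `(true, k) ↦ (false, k + s)`. -/
def tauFun (s : ZMod m) : V m → V m := fun v => (!v.1, if v.1 then v.2 + s else v.2 - s)

/-- `tauFun s` is an involution. -/
theorem tauFun_involutive (s : ZMod m) : Function.Involutive (tauFun m s) := by
  rintro ⟨b, k⟩
  cases b <;> simp [tauFun]

/-- The fixed-point-free involution `τ_s` of `Bool × ZMod m`. -/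
def tau (s : ZMod m) : Perm (V m) := (tauFun_involutive m s).toPerm _

/-- `τ_s (false, k) = (true, k - s)`. -/
@[simp] theorem tau_apply_false (s k : ZMod m) : tau m s (false, k) = (true, k - s) := rfl

/-- `τ_s (true, k) = (false, k + s)`. -/
@[simp] theorem tau_apply_true (s k : ZMod m) : tau m s (true, k) = (false, k + s) := rfl

/-- `τ_s² = 1`. -/
theorem tau_mul_self (s : ZMod m) : tau m s * tau m s = 1 := by
  ext1 v
  exact tauFun_involutive m s v

/-- `τ_s` is fixed-point-free (it changes the level). -/
theorem tau_ne (s : ZMod m) (v : V m) : tau m s v ≠ v := by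
  rcases v with ⟨b, k⟩
  cases b <;> simp [tau, tauFun, Function.Involutive.toPerm]

/-- The translation `(b, k) ↦ (b, k + a)`; it commutes with every `τ_s`. -/
def shift (a : ZMod m) : Perm (V m) := Equiv.prodCongr (Equiv.refl Bool) (Equiv.addRight a)

/-- `shift a (b, k) = (b, k + a)`. -/
@[simp] theorem shift_apply (a : ZMod m) (b : Bool) (k : ZMod m) : shift m a (b, k) = (b, k + a) := rfl

/-- Translations commute with every `τ_s`. -/
theorem shift_mul_tau (a s : ZMod m) : shift m a * tau m s = tau m s * shift m a := by
  ext1 v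
  rcases v with ⟨b, k⟩
  cases b <;> simp [Perm.mul_apply] <;> ring

/-- `ρ = τ_t ∘ τ_s` translates level `false` by `t - s`. -/
theorem tau_mul_tau_pow_apply_false (s t : ZMod m) (j : ℕ) (k : ZMod m) :
    ((tau m t * tau m s) ^ j) (false, k) = (false, k + j * (t - s)) := by
  induction j generalizing k with
  | zero => simp
  | succ j ih =>
      rw [pow_succ, Perm.mul_apply, Perm.mul_apply, tau_apply_false, tau_apply_true, ih]
      push_cast
      congr 1
      ring

/-- Semiregularity: a permutation commuting with `τ_s` and `τ_t`, `t - s` a unit, and fixing a point is `1`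
(the centraliser of the transitive group `⟨τ_s, τ_t⟩` acts freely). -/
theorem eq_one_of_comm_of_apply_eq [NeZero m] (s t : ZMod m) (hu : IsUnit (t - s)) {g : Perm (V m)}
    (hs : g * tau m s = tau m s * g) (ht : g * tau m t = tau m t * g) {x : V m} (hx : g x = x) :
    g = 1 := by
  -- `g` commutes with `ρ^j`
  have hρ : ∀ j : ℕ, g * (tau m t * tau m s) ^ j = (tau m t * tau m s) ^ j * g := by
    intro j
    have hc : Commute g (tau m t * tau m s) := (Commute.mul_right ht hs)
    exact (hc.pow_right j).eq
  -- a fixed point on level `false`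
  obtain ⟨k₀, hk₀⟩ : ∃ k₀ : ZMod m, g (false, k₀) = (false, k₀) := by
    rcases x with ⟨b, k⟩
    cases b
    · exact ⟨k, hx⟩
    · refine ⟨k + s, ?_⟩
      have h1 : g (tau m s (true, k)) = tau m s (g (true, k)) := by
        rw [← Perm.mul_apply, hs, Perm.mul_apply]
      rw [hx, tau_apply_true] at h1
      exact h1
  -- every point of level `false` is fixed
  obtain ⟨u, hu'⟩ := hu
  have hfalse : ∀ k : ZMod m, g (false, k) = (false, k) := by
    intro k
    set j : ℕ := ((k - k₀) * (↑u⁻¹ : ZMod m)).val with hj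
    have hjk : (false, k₀ + (j : ZMod m) * (t - s)) = ((false, k) : V m) := by
      rw [hj, ZMod.natCast_zmod_val, ← hu', mul_assoc, Units.inv_mul, mul_one]
      congr 1
      ring
    have h1 : g (((tau m t * tau m s) ^ j) (false, k₀)) = ((tau m t * tau m s) ^ j) (g (false, k₀)) := by
      rw [← Perm.mul_apply, hρ j, Perm.mul_apply]
    rw [hk₀, tau_mul_tau_pow_apply_false, hjk] at h1
    exact h1
  ext1 v
  rcases v with ⟨b, k⟩
  cases b
  · exact hfalse k
  · -- `(true, k) = τ_s (false, k + s)`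
    have h1 : g (tau m s (false, k + s)) = tau m s (g (false, k + s)) := by
      rw [← Perm.mul_apply, hs, Perm.mul_apply]
    rw [hfalse, tau_apply_false, add_sub_cancel_right] at h1
    exact h1

/-- The centraliser `C(τ_s)` (a hyperoctahedral group `S₂ ≀ S_m`). -/
def cent (s : ZMod m) : Subgroup (Perm (V m)) := Subgroup.centralizer ({tau m s} : Set (Perm (V m)))

/-- The point-stabiliser–centraliser subgroup `H_{s,x} = C(τ_s) ∩ Stab(x)`. -/
def stabCent (s : ZMod m) (x : V m) : Subgroup (Perm (V m)) :=
  cent m s ⊓ MulAction.stabilizer (Perm (V m)) x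

/-- Membership in `C(τ_s)` as a commutation relation. -/
theorem mem_cent_iff (s : ZMod m) (g : Perm (V m)) : g ∈ cent m s ↔ g * tau m s = tau m s * g := by
  rw [cent, Subgroup.mem_centralizer_iff]
  simp only [Set.mem_singleton_iff, forall_eq]
  exact ⟨fun h => h.symm, fun h => h.symm⟩

/-- Membership in `H_{s,x}`: commute with `τ_s` and fix `x`. -/
theorem mem_stabCent_iff (s : ZMod m) (x : V m) (g : Perm (V m)) :
    g ∈ stabCent m s x ↔ g * tau m s = tau m s * g ∧ g x = x := by
  rw [stabCent, Subgroup.mem_inf, mem_cent_iff, MulAction.mem_stabilizer_iff, Perm.smul_def]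

/-- **Pairwise triviality.** For `t - s` a unit of `ZMod m` and any points `x, y`:
`H_{s,x} ∩ H_{t,y} = 1`. -/
theorem stabCent_inf_eq_bot [NeZero m] (s t : ZMod m) (hu : IsUnit (t - s)) (x y : V m) :
    stabCent m s x ⊓ stabCent m t y = ⊥ := by
  rw [Subgroup.eq_bot_iff_forall]
  intro g hg
  rw [Subgroup.mem_inf, mem_stabCent_iff, mem_stabCent_iff] at hg
  exact eq_one_of_comm_of_apply_eq m s t hu hg.1.1 hg.2.1 hg.1.2

/-- `C(τ_s)` is transitive on `Bool × ZMod m` (translations and `τ_s` itself lie in it). -/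
theorem exists_mem_cent_apply_eq (s : ZMod m) (x y : V m) : ∃ g ∈ cent m s, g x = y := by
  rcases x with ⟨b, k⟩
  rcases y with ⟨b', k'⟩
  have hsh : ∀ a, shift m a ∈ cent m s := fun a => (mem_cent_iff m s _).2 (shift_mul_tau m a s)
  have hτ : tau m s ∈ cent m s := (mem_cent_iff m s _).2 rfl
  cases b <;> cases b'
  · exact ⟨shift m (k' - k), hsh _, by simp⟩
  · refine ⟨tau m s * shift m (k' - k + s), (cent m s).mul_mem hτ (hsh _), ?_⟩
    simp only [Perm.mul_apply, shift_apply, tau_apply_false, Prod.mk.injEq, true_and]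
    all_goals ring
  · refine ⟨tau m s * shift m (k' - k - s), (cent m s).mul_mem hτ (hsh _), ?_⟩
    simp only [Perm.mul_apply, shift_apply, tau_apply_true, Prod.mk.injEq, true_and]
    all_goals ring
  · exact ⟨shift m (k' - k), hsh _, by simp⟩

/-- `|C(τ_s)| = 2^m · m!` (the hyperoctahedral group). -/
theorem card_cent [NeZero m] (s : ZMod m) : Nat.card (cent m s) = 2 ^ m * m.factorial := by
  have h := Literature.NumberTheory.ComplexMultiplication.nat_card_centralizer_of_involutive_fixedPointFree
    (tau m s) (tau_mul_self m s) (tau_ne m s)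
  have hc : Fintype.card (V m) / 2 = m := by
    rw [Fintype.card_prod, Fintype.card_bool, ZMod.card, Nat.mul_div_cancel_left _ two_pos]
  rw [hc] at h
  exact h

/-- **Order count.** `|H_{s,x}| = 2^(m-1) · (m-1)!` (orbit–stabiliser in the transitive group `C(τ_s)`). -/
theorem card_stabCent [NeZero m] (s : ZMod m) (x : V m) :
    Nat.card (stabCent m s x) = 2 ^ (m - 1) * (m - 1).factorial := by
  haveI : MulAction.IsPretransitive (cent m s) (V m) := ⟨fun a b => by
    obtain ⟨g, hg, hga⟩ := exists_mem_cent_apply_eq m s a b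
    exact ⟨⟨g, hg⟩, by rw [Subgroup.mk_smul, Perm.smul_def, hga]⟩⟩
  have hidx : (MulAction.stabilizer (cent m s) x).index = 2 * m := by
    rw [MulAction.index_stabilizer_of_transitive, Nat.card_eq_fintype_card, Fintype.card_prod,
      Fintype.card_bool, ZMod.card]
  have hmul := (MulAction.stabilizer (cent m s) x).card_mul_index
  rw [hidx, card_cent] at hmul
  -- identify the two stabilisers
  have hcongr : Nat.card (stabCent m s x) = Nat.card (MulAction.stabilizer (cent m s) x) := by
    refine Nat.card_congr
      { toFun := fun g => ⟨⟨g.1, (Subgroup.mem_inf.mp g.2).1⟩, by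
          rw [MulAction.mem_stabilizer_iff, Subgroup.mk_smul]
          exact (Subgroup.mem_inf.mp g.2).2⟩
        invFun := fun g => ⟨g.1.1, Subgroup.mem_inf.mpr ⟨g.1.2, by
          have h := MulAction.mem_stabilizer_iff.mp g.2
          rw [Subgroup.smul_def] at h
          exact MulAction.mem_stabilizer_iff.mpr h⟩⟩
        left_inv := fun g => rfl
        right_inv := fun g => rfl }
  rw [hcongr]
  -- arithmetic: `N · 2m = 2^m · m!` forces `N = 2^(m-1) · (m-1)!`
  have hm : m ≠ 0 := NeZero.ne m
  obtain ⟨k, rfl⟩ : ∃ k, m = k + 1 := ⟨m - 1, (Nat.succ_pred_eq_of_ne_zero hm).symm⟩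
  simp only [Nat.add_sub_cancel] 
  have h2 : 2 ^ (k + 1) * (k + 1).factorial = (2 ^ k * k.factorial) * (2 * (k + 1)) := by
    rw [pow_succ, Nat.factorial_succ]; ring
  rw [h2] at hmul
  exact Nat.eq_of_mul_eq_mul_right (by positivity) hmul

/-- The orders against the square-root threshold: `(|H_{s,x}| · 2m)² = (2^m m!)² ≥ (2m)!`, i.e. the product of
three such orders is at least `(2m)!^{3/2} / (2m)^3`. -/
theorem card_stabCent_sq_ge [NeZero m] (s : ZMod m) (x : V m) :
    (2 * m).factorial ≤ (Nat.card (stabCent m s x) * (2 * m)) ^ 2 := by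
  rw [card_stabCent]
  have hm : m ≠ 0 := NeZero.ne m
  obtain ⟨k, rfl⟩ : ∃ k, m = k + 1 := ⟨m - 1, (Nat.succ_pred_eq_of_ne_zero hm).symm⟩
  simp only [Nat.add_sub_cancel]
  have h2 : 2 ^ k * k.factorial * (2 * (k + 1)) = 2 ^ (k + 1) * (k + 1).factorial := by
    rw [pow_succ, Nat.factorial_succ]; ring
  rw [h2]
  -- `(2m)! = C(2m, m) · m! · m!` and `C(2m, m) ≤ 2^(2m)`
  set n := k + 1
  have hch := Nat.choose_mul_factorial_mul_factorial (by omega : n ≤ 2 * n)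
  rw [show 2 * n - n = n by omega] at hch
  have hle := Nat.choose_le_two_pow (2 * n) n
  calc (2 * n).factorial = (2 * n).choose n * n.factorial * n.factorial := hch.symm
    _ ≤ 2 ^ (2 * n) * n.factorial * n.factorial := by gcongr
    _ = (2 ^ n * n.factorial) ^ 2 := by ring

/-- `2` is a unit modulo an odd `m`. -/
theorem isUnit_two_of_odd (hm : Odd m) : IsUnit (2 : ZMod m) := by
  obtain ⟨k, hk⟩ := hm
  refine isUnit_iff_exists_inv.mpr ⟨(k : ZMod m) + 1, ?_⟩
  have h : ((2 * k + 1 : ℕ) : ZMod m) = 0 := by rw [← hk, ZMod.natCast_self]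
  push_cast at h
  linear_combination h

/-- **The hyperoctahedral triple** (odd `m`, arbitrary points): the three point-stabiliser–centraliser subgroups
for the shifts `0, 1, 2` are pairwise trivially intersecting and each has order `2^(m-1)·(m-1)!`. -/
theorem hyperoctahedral_triple [NeZero m] (hm : Odd m) (x₀ x₁ x₂ : V m) :
    stabCent m 0 x₀ ⊓ stabCent m 1 x₁ = ⊥ ∧ stabCent m 0 x₀ ⊓ stabCent m 2 x₂ = ⊥ ∧
      stabCent m 1 x₁ ⊓ stabCent m 2 x₂ = ⊥ ∧
      Nat.card (stabCent m 0 x₀) = 2 ^ (m - 1) * (m - 1).factorial ∧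
      Nat.card (stabCent m 1 x₁) = 2 ^ (m - 1) * (m - 1).factorial ∧
      Nat.card (stabCent m 2 x₂) = 2 ^ (m - 1) * (m - 1).factorial := by
  refine ⟨stabCent_inf_eq_bot m 0 1 (by simp) x₀ x₁,
    stabCent_inf_eq_bot m 0 2 (by simpa using isUnit_two_of_odd m hm) x₀ x₂,
    stabCent_inf_eq_bot m 1 2 (by norm_num) x₁ x₂,
    card_stabCent m 0 x₀, card_stabCent m 1 x₁, card_stabCent m 2 x₂⟩

/-- **Transport to `S_{2m} = Equiv.Perm (Fin (2m))`.**  For every odd `m ≥ 1` there are three pairwise trivially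
intersecting subgroups of `S_{2m}`, each of order `2^(m-1)·(m-1)!`; by `card_stabCent_sq_ge` the product of the
orders is `≥ (2m)!^{3/2}/(2m)^3` — contrast [BCCGU17, Thm 4.2] for Young subgroups (`≤ n!^{3/2} e^{-cn}`). -/
theorem exists_pairwise_trivial_triple (hm : Odd m) :
    ∃ H₁ H₂ H₃ : Subgroup (Perm (Fin (2 * m))),
      H₁ ⊓ H₂ = ⊥ ∧ H₁ ⊓ H₃ = ⊥ ∧ H₂ ⊓ H₃ = ⊥ ∧
      Nat.card H₁ = 2 ^ (m - 1) * (m - 1).factorial ∧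
      Nat.card H₂ = 2 ^ (m - 1) * (m - 1).factorial ∧
      Nat.card H₃ = 2 ^ (m - 1) * (m - 1).factorial := by
  haveI : NeZero m := ⟨by obtain ⟨k, hk⟩ := hm; omega⟩
  -- an equivalence `Bool × ZMod m ≃ Fin (2m)` and the induced isomorphism of symmetric groups
  have hcard : Fintype.card (V m) = Fintype.card (Fin (2 * m)) := by
    rw [Fintype.card_prod, Fintype.card_bool, ZMod.card, Fintype.card_fin]
  let e : V m ≃ Fin (2 * m) := Fintype.equivOfCardEq hcard
  let φ : Perm (V m) ≃* Perm (Fin (2 * m)) := Equiv.permCongrHom e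
  have hφ : Function.Injective φ.toMonoidHom := φ.injective
  let x : V m := (false, 0)
  obtain ⟨h01, h02, h12, c0, c1, c2⟩ := hyperoctahedral_triple m hm x x x
  refine ⟨(stabCent m 0 x).map φ.toMonoidHom, (stabCent m 1 x).map φ.toMonoidHom,
    (stabCent m 2 x).map φ.toMonoidHom, ?_, ?_, ?_, ?_, ?_, ?_⟩
  · rw [← Subgroup.map_inf_eq _ _ _ hφ, h01, Subgroup.map_bot]
  · rw [← Subgroup.map_inf_eq _ _ _ hφ, h02, Subgroup.map_bot]
  · rw [← Subgroup.map_inf_eq _ _ _ hφ, h12, Subgroup.map_bot]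
  · rw [Subgroup.card_map_of_injective hφ, c0]
  · rw [Subgroup.card_map_of_injective hφ, c1]
  · rw [Subgroup.card_map_of_injective hφ, c2]

/-- **Square-root size, pairwise trivial, inside `S_{2m}`.**  For every odd `m` there are pairwise trivially
intersecting `H₁, H₂, H₃ ≤ S_{2m}` with `(|H₁||H₂||H₃|·(2m)³)² ≥ (2m)!³`, i.e.
`|H₁||H₂||H₃| ≥ (2m)!^{3/2}/(2m)³`: the pairwise-trivial hypothesis of [BCCGU17, Thm 4.2] alone costs at most a
polynomial factor against `n!^{3/2}`, whereas for Young subgroups it costs `e^{cn}`. -/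
theorem exists_pairwise_trivial_triple_sqrt (hm : Odd m) :
    ∃ H₁ H₂ H₃ : Subgroup (Perm (Fin (2 * m))),
      H₁ ⊓ H₂ = ⊥ ∧ H₁ ⊓ H₃ = ⊥ ∧ H₂ ⊓ H₃ = ⊥ ∧
      (2 * m).factorial ^ 3 ≤ (Nat.card H₁ * Nat.card H₂ * Nat.card H₃ * (2 * m) ^ 3) ^ 2 := by
  haveI : NeZero m := ⟨by obtain ⟨k, hk⟩ := hm; omega⟩
  obtain ⟨H₁, H₂, H₃, h12, h13, h23, c1, c2, c3⟩ := exists_pairwise_trivial_triple m hm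
  refine ⟨H₁, H₂, H₃, h12, h13, h23, ?_⟩
  have hsq := card_stabCent_sq_ge m 0 ((false, 0) : V m)
  rw [card_stabCent] at hsq
  rw [c1, c2, c3]
  calc (2 * m).factorial ^ 3 ≤ ((2 ^ (m - 1) * (m - 1).factorial * (2 * m)) ^ 2) ^ 3 :=
        Nat.pow_le_pow_left hsq 3
    _ = (2 ^ (m - 1) * (m - 1).factorial * (2 ^ (m - 1) * (m - 1).factorial) *
          (2 ^ (m - 1) * (m - 1).factorial) * (2 * m) ^ 3) ^ 2 := by ring

end Summit.MatrixMultiplication.MatrixMultiplication.Theorems.HyperoctahedralPairwise
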